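import Summits.HodgeConjecture.HodgeConjecture.Theorems.EquidimThickIffLe
import Summits.HodgeConjecture.HodgeConjecture.Theorems.EquidimHeckeLinkedAtLift
import Summits.HodgeConjecture.HodgeConjecture.Theorems.EquidimExistsThickPieceAt
import Summits.HodgeConjecture.HodgeConjecture.Theorems.EquidimThickLift
import Summits.HodgeConjecture.HodgeConjecture.Theorems.UHeadUa
import Summits.HodgeConjecture.HodgeConjecture.Theorems.UeP4OfFPiece
import Summits.HodgeConjecture.CorCM.D2Bridge.ShimuraComponentMaps
import Literature.AlgebraicGeometry.ModuliOfAbelianVarieties.SiegelModuliThickPoints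
import Literature.AlgebraicGeometry.ModuliOfAbelianVarieties.SiegelEllAdicHeckeMove
import Literature.AlgebraicGeometry.ModuliOfAbelianVarieties.SiegelHeckeLink
import Literature.AlgebraicGeometry.ModuliOfAbelianVarieties.SiegelAdmissibleAlignReadings
import Literature.AlgebraicGeometry.ModuliOfAbelianVarieties.SiegelModuliTowerSurjective
import Literature.AlgebraicGeometry.ModuliOfAbelianVarieties.SiegelModuliTowerLiftsRelDim
import HarnessLib

/-!
# The thick Hecke-linked lift — socket (A) of the Hecke link of the E-road «EQUIDIM by proof»

Layer `Summits/HodgeConjecture/HodgeConjecture/Theorems` (helper toward the crux `stub_noThinPiece` of the registered skeleton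
`Cruxes/HDel/Lines/EquidimOfF.lean`, item stmt-HodgeConjecture-24835; cell hodgecm-mathlib, Hecke-link line card v1.1, B-plan1 (g14)
rulings 2026-08-29T19:31:36Z (1) and 21:19:42Z).  THEOREMS ONLY.  The E-road closes `NoThinPiece` by `noThinPiece_of_heckeBricks
(hLift : SocketThickLinkedLift HeckeLinked) (hQuot : SocketQuotientMap HeckeLinked)`; this file proves the CONTENT of the first socket
as the theorem `thickLinkedLift_heckeLinked` (the socket's `∀`-body with `Linked := ` ★ `HeckeLinked` and the P4-piece hypothesis
discharged by ★ `ue_P4_piece_of_F`), so that `socketThickLinkedLift_holds := fun hF _ g N δ hg hδ hN 𝓜 x ↦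
thickLinkedLift_heckeLinked hF g N δ hg hδ hN 𝓜 x`.  The two primed lemmas are the ★ bricks (U) and (A4) with a level VARIABLE
`N′ = N·m` (tower typing: `SiegelLevel.N` is opaque, never syntactically a product).  HC_CM is proved only modulo the 7 printed
citations until rung 0 closes; this file discharges none of them.

## References
* [MumfordFogartyKirwan1994] D. Mumford, J. Fogarty, F. Kirwan, *Geometric Invariant Theory*, 3rd ed., App. 7A (p. 235).
* [Milne2005ShimuraVarieties] J. S. Milne, *Introduction to Shimura Varieties*, §6 Thm. 6.11 pp. 74–75.
* [PlatonovRapinchuk1994] V. Platonov, A. Rapinchuk, *Algebraic Groups and Number Theory*, §7.4 Thm. 7.12.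
-/

set_option linter.dupNamespace false

noncomputable section

open CategoryTheory AlgebraicGeometry Matrix Topology
open Literature.AlgebraicGeometry
open Literature.AlgebraicGeometry.Motives (SchemeOver ComplexPoints AlgPoints specOver)
open Literature.AlgebraicGeometry.AbelianSchemes (PolarizedAbelianSchemeWithLevel)
open Literature.AlgebraicGeometry.ModuliOfAbelianVarieties
open Literature.NumberTheory.Automorphic (siegelUpperHalfSpace)
open Literature.NumberTheory.Adeles
open Literature.NumberTheory.ModularForms Literature.NumberTheory.ModularForms.SiegelUpperHalfSpace

namespace Summit.HodgeConjecture.HodgeConjecture.Theorems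

namespace EquidimSocketThickLinkedLift

open SiegelModuli SiegelModuliTower
open Summit.HodgeConjecture.CorCM.HypDel.UHead (exists_residue_isAdmissibleAt isAdmissibleAt_of_classifyingMap_eq)

variable {g : ℕ} {δ : Fin g → ℕ}

/-- (U)′ — ★ (U) `exists_isAdmissibleAt_mul_of_changeLevel` with a level VARIABLE `N′ = N·m` (tower typing: `SiegelLevel.N` is never
syntactically a product). [cite: Milne2005ShimuraVarieties, §6 Thm. 6.11 pp. 74–75, Lemma 5.13 p. 57] -/
theorem exists_isAdmissibleAt_mul_of_changeLevel' (hg : 0 < g) (hδ : IsPolarizationType δ) {N : ℕ} (hN : 3 ≤ N)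
    {r r₀ : gspFinAdelic δ} (hr : r ∈ principalLevelSubgroup δ 1) (hr₀ : r₀ ∈ principalLevelSubgroup δ 1)
    (Z Z₀ : siegelUpperHalfSpace g) {m : ℕ} (hm : 0 < m) (N' : ℕ) (hN' : N' = N * m) (hN'0 : N' ≠ 0)
    (P₀' : PolarizedAbelianSchemeWithLevel g N' δ (specOver ℚ ℂ).left)
    (h₀ : IsAdmissibleAt hδ r₀ Z₀.1 Z₀.2 P₀')
    (h : IsAdmissibleAt hδ r Z.1 Z.2 (P₀'.changeLevel N m hN' hN'0)) :
    ∃ u ∈ principalLevelSubgroup δ N, IsAdmissibleAt hδ (r * u) Z.1 Z.2 P₀' := by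
  subst hN'
  exact exists_isAdmissibleAt_mul_of_changeLevel hg hδ hN hr hr₀ Z Z₀ hm P₀' h₀ h

/-- (A4)′ — ★ (A4) `EquidimHeckeLink.heckeLinked_at_ellAdicMove` with a level VARIABLE `N′ = N·ℓᴷ`.
[cite: Milne2005ShimuraVarieties, §6 Thm. 6.11 pp. 74–75] -/
theorem heckeLinked_at_ellAdicMove' (hg : 0 < g) (hδ : IsPolarizationType δ) {N : ℕ} (hN : 3 ≤ N) {ℓ K : ℕ} (hℓ : 2 ≤ ℓ)
    (N' : ℕ) (hN' : N' = N * ℓ ^ K)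
    (𝓜 : SiegelFineModuliScheme g N δ) (𝓜' : SiegelFineModuliScheme g N' δ)
    [IsLocallyNoetherian (specOver ℚ ℂ).left]
    (P : Matrix.symplecticGroup (Fin g) ℝ) (γ : GL (Fin g ⊕ Fin g) ℚ)
    (hP : ∀ Z : siegelUpperHalfSpace g, jOfSiegel δ ((P⁻¹ • Z : siegelUpperHalfSpace g) : Matrix (Fin g) (Fin g) ℂ) =
      conjJ (Matrix.GeneralLinearGroup.map (algebraMap ℚ ℝ) γ) (jOfSiegel δ ((Z : siegelUpperHalfSpace g) : Matrix (Fin g) (Fin g) ℂ)))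
    (hγ : ∀ i j, ∃ z : ℤ, (γ : Matrix (Fin g ⊕ Fin g) (Fin g ⊕ Fin g) ℚ) i j = z)
    (hγ' : ∀ i j, ∃ z : ℤ,
      (ℓ : ℚ) ^ K * ((γ⁻¹ : GL (Fin g ⊕ Fin g) ℚ) : Matrix (Fin g ⊕ Fin g) (Fin g ⊕ Fin g) ℚ) i j = z)
    (hsim : (γ : Matrix (Fin g ⊕ Fin g) (Fin g ⊕ Fin g) ℚ)ᵀ * typeFormOver δ ℚ *
      (γ : Matrix (Fin g ⊕ Fin g) (Fin g ⊕ Fin g) ℚ) = ((ℓ : ℚ) ^ K) • typeFormOver δ ℚ)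
    (hγN : ∀ i j, ∃ z : ℤ, (γ : Matrix (Fin g ⊕ Fin g) (Fin g ⊕ Fin g) ℚ) i j -
      (1 : Matrix (Fin g ⊕ Fin g) (Fin g ⊕ Fin g) ℚ) i j = (N : ℚ) * z)
    {r u : gspFinAdelic δ} (hr : r ∈ principalLevelSubgroup δ 1) (hu : u ∈ principalLevelSubgroup δ N)
    {x : ComplexPoints ((Motives.baseChange ℚ ℂ).obj 𝓜.M)} (Zx : siegelUpperHalfSpace g)
    (Px : PolarizedAbelianSchemeWithLevel g N δ (specOver ℚ ℂ).left) (hPx : IsAdmissibleAt hδ r Zx.1 Zx.2 Px)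
    (hx : AlgPoints.baseChangeEquiv (algebraMap ℚ ℂ) 𝓜.M (𝓜.classifyingMap (specOver ℚ ℂ) Px) = x)
    {y : ComplexPoints ((Motives.baseChange ℚ ℂ).obj 𝓜'.M)}
    (P₀' : PolarizedAbelianSchemeWithLevel g N' δ (specOver ℚ ℂ).left)
    (hP₀' : IsAdmissibleAt hδ (r * u) (P • Zx : siegelUpperHalfSpace g).1 (P • Zx : siegelUpperHalfSpace g).2 P₀')
    (hy : AlgPoints.baseChangeEquiv (algebraMap ℚ ℂ) 𝓜'.M (𝓜'.classifyingMap (specOver ℚ ℂ) P₀') = y) :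
    HeckeLinked 𝓜 𝓜' (r * u) y x := by
  subst hN'
  exact EquidimHeckeLink.heckeLinked_at_ellAdicMove hg hδ hN hℓ 𝓜 𝓜' P γ hP hγ hγ' hsim hγN hr hu Zx Px hPx hx P₀' hP₀' hy

/-- **THE THICK HECKE-LINKED LIFT (socket (A) of the Hecke link, as a theorem).**  Under (F) [Lan2013], for every Siegel fine
moduli scheme `𝓜` (any `g ≥ 1`, polarisation type `δ`, level `N ≥ 3`) and every complex point `x` of `𝓜_ℂ` there are a level
`N′` (`= N·ℓᴷ`, `ℓ = N+1`), a fine moduli scheme `𝓜′` of that level, a smooth open piece `ι′ : S″ ⟶ 𝓜′_ℂ` of relative dimension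
`d″`, a principal representative `r′ ∈ K_δ(1)` and a complex point `s′` of `S″` such that `S″` is THICK at `s′` read at `r′`
(★ `EquidimOfF.IsThickAtWith`) and `ι′ s′` is HECKE-LINKED to `x` at `r′` (★ `HeckeLinked`).  Assembly of ★ bricks: `x`'s triple
and residue reading (★ `exists_triple_isBaseChangeVia_classifyingPoint_eq`, ★ `exists_residue_isAdmissibleAt`), U-a at that reading
(★ `UHead.Ua_holds_of_residual`), a thick piece through `x`'s component (★ H0_c `EquidimThickPiece.exists_openPiece_le_at`), its
period chart read at `r` (★ `EquidimThickIffLe.isThickAtWith_of_isAdmissibleAt`) giving an open set of periods, the `ℓ`-adic move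
into it (★ B3+ `exists_ellAdicMove_integral`), the thick lift along the tower (★ `EquidimThickLift.exists_lift_le_relDim` over ★ (P1)
`SiegelModuliTower.exists_comp_tr_eq` and ★ (R4) `SiegelModuliTower.trLiftsRelDim`), the reading alignment (★ (U)
`exists_isAdmissibleAt_mul_of_changeLevel`) and the link at the lifted point (★ (A4) `EquidimHeckeLink.heckeLinked_at_ellAdicMove`).
This is the body of the E-road socket `SocketThickLinkedLift HeckeLinked` with its `hP4` binder discharged by ★
`UeP4OfFPiece.ue_P4_piece_of_F hF`. [cite: MumfordFogartyKirwan1994, App. 7A (p. 235)]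
[cite: Milne2005ShimuraVarieties, §6 Thm. 6.11 pp. 74–75] [cite: PlatonovRapinchuk1994, §7.4 Thm. 7.12] -/
theorem thickLinkedLift_heckeLinked (hF : lan2013_siegelFineModuliScheme) (g N : ℕ) (δ : Fin g → ℕ) (hg : 0 < g)
    (hδ : IsPolarizationType δ) (hN : 3 ≤ N) (𝓜 : SiegelFineModuliScheme g N δ)
    (x : ComplexPoints ((Motives.baseChange ℚ ℂ).obj 𝓜.M)) :
    ∃ (N' : ℕ) (δ' : Fin g → ℕ) (hδ' : IsPolarizationType δ') (𝓜' : SiegelFineModuliScheme g N' δ')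
      (S'' : SchemeOver ℂ) (ι' : S'' ⟶ (Motives.baseChange ℚ ℂ).obj 𝓜'.M)
      (d'' : ℕ) (_ : SmoothOfRelativeDimension d'' S''.hom) (r' : gspFinAdelic δ') (_ : r' ∈ principalLevelSubgroup δ' 1)
      (s' : ComplexPoints S''),
      EquidimOfF.IsThickAtWith hδ' 𝓜' ι' d'' s' r' ∧ HeckeLinked 𝓜 𝓜' r' (AlgPoints.map (L := ℂ) ι' s') x := by
  have hP4 := UeP4OfFPiece.ue_P4_piece_of_F hF
  have hLiftRD : ∀ {g : ℕ} {δ : Fin g → ℕ} (hg : 0 < g)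
      (𝓜 : ∀ K : SiegelLevel δ, SiegelFineModuliScheme g K.N δ) {K K' : SiegelLevel δ} (f : K ⟶ K')
      (_hK : Smooth (𝓜 K).M.hom) (_hK' : Smooth (𝓜 K').M.hom)
      {S'' S' : SchemeOver ℂ} (ι'' : S'' ⟶ (Motives.baseChange ℚ ℂ).obj (𝓜 K).M) [IsOpenImmersion ι''.left]
      (d'' : ℕ) [SmoothOfRelativeDimension d'' S''.hom]
      (ι : S' ⟶ (Motives.baseChange ℚ ℂ).obj (𝓜 K').M) [IsOpenImmersion ι.left] (d : ℕ) [SmoothOfRelativeDimension d S'.hom]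
      (s'' : ComplexPoints S'') (s : ComplexPoints S'),
      AlgPoints.map ((Motives.baseChange ℚ ℂ).map (tr hg 𝓜 f)) (AlgPoints.map ι'' s'') = AlgPoints.map ι s → d ≤ d'' := by
    intro g δ hg 𝓜 K K' f hK hK' S'' S' ι'' _ d'' _ ι _ d _ s'' s h
    exact SiegelModuliTower.trLiftsRelDim hg 𝓜 f hK hK' ι'' d'' ι d s'' s h
  classical
  haveI : IsLocallyNoetherian (specOver ℚ ℂ).left := inferInstanceAs (IsLocallyNoetherian (Spec (CommRingCat.of ℂ)))
  -- ### tower typing: `N = K₀.N`, `𝓜 = 𝓜f K₀`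
  -- (the witnesses are hidden behind `have`s so that `K₀`, `𝓜f` stay OPAQUE locals — no `Function.update` unfolding later)
  have hK₀ : ∃ K₀ : SiegelLevel δ, K₀.N = N := ⟨SiegelLevel.ofNat δ N hN, SiegelLevel.N_ofNat hg N hN⟩
  obtain ⟨K₀, rfl⟩ := hK₀
  have h𝓜f : ∃ 𝓜f : ∀ K : SiegelLevel δ, SiegelFineModuliScheme g K.N δ, 𝓜f K₀ = 𝓜 :=
    ⟨Function.update (fun K ↦ (hF g K.N δ hg hδ K.three_le_N).choose) K₀ 𝓜,
      Function.update_self (β := fun K : SiegelLevel δ ↦ SiegelFineModuliScheme g K.N δ) K₀ 𝓜 _⟩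
  obtain ⟨𝓜f, rfl⟩ := h𝓜f
  have hN0 : 0 < K₀.N := by have := K₀.three_le_N; omega
  haveI : Fact (1 < K₀.N) := ⟨by have := K₀.three_le_N; omega⟩
  -- ### `x`'s triple and its reading `(Zx, r)`, `r` of residue form
  obtain ⟨Px, -, -, -, hx⟩ := (𝓜f K₀).exists_triple_isBaseChangeVia_classifyingPoint_eq x
  obtain ⟨c, u₀, r, hu1, huc, hr, hmult, hrform, Zx, hZx, hPx⟩ := exists_residue_isAdmissibleAt hg hδ K₀.three_le_N Px
  have hUa := UHead.Ua_holds_of_residual Literature.AlgebraicGeometry.Motives.AbelianVariety.U_a3_residual_of_M13 g K₀.N δ hg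
    hδ K₀.three_le_N c u₀ r hu1 huc hr hmult hrform
  -- ### H0_c: a thick piece with a point read at `r`; its period chart read at `r`; the open set `V` of periods
  obtain ⟨S₀, ι₀, hι₀, d₀, hd₀, t₀, Z₀, hZ₀, P₀, hG, hadm₀, hcls₀⟩ :=
    EquidimThickPiece.exists_openPiece_le_at hF hP4 hg hδ K₀.three_le_N (𝓜f K₀) hr hUa
  haveI := hι₀
  haveI := hd₀
  haveI : Smooth S₀.hom := SmoothOfRelativeDimension.smooth d₀ _
  haveI : LocallyOfFiniteType S₀.hom := inferInstance
  obtain ⟨W, π, hWo, ht₀W, -, -, hread, hopen⟩ :=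
    EquidimThickIffLe.isThickAtWith_of_isAdmissibleAt hF hg hδ K₀.three_le_N (𝓜f K₀) ι₀ d₀ t₀ hG hr (Z := ⟨Z₀, hZ₀⟩) P₀ hadm₀ hcls₀
  obtain ⟨V, hVo, hVne, hVsub⟩ := hopen Set.univ isOpen_univ (Set.mem_univ _)
  -- ### B3+: the `ℓ`-adic move into `V`, `ℓ = N + 1`
  have hℓ : 2 ≤ K₀.N + 1 := by omega
  have hcop : Nat.Coprime (K₀.N + 1) K₀.N := Nat.coprime_self_add_left.mpr (Nat.coprime_one_left _)
  obtain ⟨P, γ, Kx, hPV, hJ, hγ, hγN, hγ', hsim⟩ :=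
    exists_ellAdicMove_integral (K₀.N + 1) K₀.N hℓ hN0 hcop hδ.1 ⟨Zx, hZx⟩ hVo hVne
  -- the moved period is the period of a point `t′` of the thick piece, with a triple `Q` admissible at `(P • Zx, r)`
  obtain ⟨t', ht', hπt'⟩ := hVsub ⟨_, hPV, rfl⟩
  obtain ⟨hπZ, Q, hQadm, hQcls⟩ := hread t' ht'.1.1
  -- ### the upstairs level `K`, `K.N = N·ℓ^Kx`, and `f : K ⟶ K₀`
  have h3 : 3 ≤ K₀.N * (K₀.N + 1) ^ Kx := le_mul_of_le_of_one_le K₀.three_le_N (Nat.one_le_pow _ _ (by omega))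
  have hKex : ∃ K : SiegelLevel δ, K.N = K₀.N * (K₀.N + 1) ^ Kx :=
    ⟨SiegelLevel.ofNat δ _ h3, SiegelLevel.N_ofNat hg _ h3⟩
  obtain ⟨K, hK⟩ := hKex
  have hle : K ≤ K₀ := by
    change (K.1 : Subgroup (gspFinAdelic δ)) ≤ K₀.1
    rw [SiegelLevel.val_eq, SiegelLevel.val_eq]
    exact principalLevelSubgroup_anti δ (Dvd.intro _ hK.symm)
  let f : K ⟶ K₀ := homOfLE hle
  have hKN0 : K.N ≠ 0 := by have := K.three_le_N; omega
  -- smoothness of the members (for (R4))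
  obtain ⟨hMsK, -, -⟩ := W1.smooth_qproj_of_F hF hg hδ K.three_le_N (𝓜f K)
  obtain ⟨hMsK₀, -, -⟩ := W1.smooth_qproj_of_F hF hg hδ K₀.three_le_N (𝓜f K₀)
  -- ### the THICK LIFT of `t′`
  obtain ⟨S'', ι', hι', -, -, d'', hd'', y, hdle, hy⟩ :=
    EquidimThickLift.exists_lift_le_relDim hF hg hδ 𝓜f f (SiegelModuliTower.exists_comp_tr_eq hg 𝓜f f)
      (fun ι'' _ d'' _ ι _ d _ s'' s h ↦ hLiftRD hg 𝓜f f hMsK hMsK₀ ι'' d'' ι d s'' s h) ι₀ d₀ t'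
  haveI := hι'
  haveI := hd''
  haveI : Smooth S''.hom := SmoothOfRelativeDimension.smooth d'' _
  haveI : LocallyOfFiniteType S''.hom := inferInstance
  -- ### `y`'s triple `P₀′` (level `K.N`), its shadow is classified like `Q` ⇒ admissible at `(P • Zx, r)`
  obtain ⟨P₀', -, -, -, hy'⟩ := (𝓜f K).exists_triple_isBaseChangeVia_classifyingPoint_eq (AlgPoints.map ι' y)
  have hshadow : ∀ (m : ℕ) (hKm : K.N = K₀.N * m), m = K.N / K₀.N →
      IsAdmissibleAt hδ r _ hπZ (P₀'.changeLevel K₀.N m hKm hKN0) := by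
    rintro m hKm rfl
    refine isAdmissibleAt_of_classifyingMap_eq hδ (𝓜f K₀) ?_ hQadm
    -- `cls Q = cls (shadow) = cls P₀′ ≫ tr f`, read on complex points: `cls Q ↦ ι₀ t′ = tr_ℂ (ι′ y)`
    apply (AlgPoints.baseChangeEquiv (algebraMap ℚ ℂ) (𝓜f K₀).M).injective
    rw [hQcls, ← classifyingMap_comp_tr hg 𝓜f f]
    have hnat := Summit.HodgeConjecture.CorCM.D2Bridge.AlgPoints.baseChangeEquiv_map (algebraMap ℚ ℂ) (tr hg 𝓜f f)
      ((𝓜f K).classifyingMap (specOver ℚ ℂ) P₀')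
    change AlgPoints.baseChangeEquiv (algebraMap ℚ ℂ) (𝓜f K₀).M (AlgPoints.map (tr hg 𝓜f f) _) =
      AlgPoints.map ((Motives.baseChange ℚ ℂ).map (tr hg 𝓜f f)) _ at hnat
    rw [AlgPoints.map_apply] at hnat
    rw [hnat, hy', hy]
  have hm : (K₀.N + 1) ^ Kx = K.N / K₀.N := by rw [hK, Nat.mul_div_cancel_left _ hN0]
  have hadm_sh := hshadow ((K₀.N + 1) ^ Kx) hK hm
  -- ### (U): align the reading of `P₀′` to `(P • Zx, r·u)`
  obtain ⟨-, -, r₀, -, -, hr₀, -, -, Z₀', hZ₀', hP₀'read⟩ := exists_residue_isAdmissibleAt hg hδ K.three_le_N P₀'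
  obtain ⟨u, hu, hadm'⟩ := exists_isAdmissibleAt_mul_of_changeLevel' hg hδ K₀.three_le_N hr hr₀
    (P • (⟨Zx, hZx⟩ : siegelUpperHalfSpace g)) ⟨Z₀', hZ₀'⟩ (Nat.pow_pos (by omega)) K.N hK hKN0 P₀' hP₀'read
    (by simpa [hπt'] using hadm_sh)
  have hru : r * u ∈ principalLevelSubgroup δ 1 :=
    Subgroup.mul_mem _ hr (principalLevelSubgroup_anti δ (one_dvd K₀.N) hu)
  -- ### thickness at `y` read at `r·u`, and the link
  have hthick : EquidimOfF.IsThickAtWith hδ (𝓜f K) ι' d'' y (r * u) :=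
    EquidimThickIffLe.isThickAtWith_of_isAdmissibleAt hF hg hδ K.three_le_N (𝓜f K) ι' d'' y (hG.trans hdle) hru
      (Z := P • (⟨Zx, hZx⟩ : siegelUpperHalfSpace g)) P₀' hadm' hy'
  have hlink : HeckeLinked (𝓜f K₀) (𝓜f K) (r * u) (AlgPoints.map (L := ℂ) ι' y) x :=
    heckeLinked_at_ellAdicMove' hg hδ K₀.three_le_N hℓ K.N hK (𝓜f K₀) (𝓜f K) P γ hJ hγ hγ' hsim hγN hr hu
      ⟨Zx, hZx⟩ Px hPx hx P₀' hadm' hy'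
  exact ⟨K.N, δ, hδ, 𝓜f K, S'', ι', d'', hd'', r * u, hru, y, hthick, hlink⟩

/-- **THE THICK HECKE-LINKED LIFT ALONG A PRESCRIBED PRIME-TO-`N` TOWER `N′ = N·ℓᴷ`** (ed.2 of `thickLinkedLift_heckeLinked`:
the same assembly with the `ℓ`-adic move for ANY `ℓ ≥ 2` coprime to `N`, and the level exported as `N′ = N·ℓᴷ`; B-plan1 (g14)
2026-08-29T21:50:29Z sockets v6 — socket (B) needs the parity of `N′/N`).  ORIGINAL DOCSTRING:  Under (F) [Lan2013], for every Siegel fine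
moduli scheme `𝓜` (any `g ≥ 1`, polarisation type `δ`, level `N ≥ 3`) and every complex point `x` of `𝓜_ℂ` there are a level
`N′` (`= N·ℓᴷ`, `ℓ = N+1`), a fine moduli scheme `𝓜′` of that level, a smooth open piece `ι′ : S″ ⟶ 𝓜′_ℂ` of relative dimension
`d″`, a principal representative `r′ ∈ K_δ(1)` and a complex point `s′` of `S″` such that `S″` is THICK at `s′` read at `r′`
(★ `EquidimOfF.IsThickAtWith`) and `ι′ s′` is HECKE-LINKED to `x` at `r′` (★ `HeckeLinked`).  Assembly of ★ bricks: `x`'s triple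
and residue reading (★ `exists_triple_isBaseChangeVia_classifyingPoint_eq`, ★ `exists_residue_isAdmissibleAt`), U-a at that reading
(★ `UHead.Ua_holds_of_residual`), a thick piece through `x`'s component (★ H0_c `EquidimThickPiece.exists_openPiece_le_at`), its
period chart read at `r` (★ `EquidimThickIffLe.isThickAtWith_of_isAdmissibleAt`) giving an open set of periods, the `ℓ`-adic move
into it (★ B3+ `exists_ellAdicMove_integral`), the thick lift along the tower (★ `EquidimThickLift.exists_lift_le_relDim` over ★ (P1)
`SiegelModuliTower.exists_comp_tr_eq` and ★ (R4) `SiegelModuliTower.trLiftsRelDim`), the reading alignment (★ (U)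
`exists_isAdmissibleAt_mul_of_changeLevel`) and the link at the lifted point (★ (A4) `EquidimHeckeLink.heckeLinked_at_ellAdicMove`).
This is the body of the E-road socket `SocketThickLinkedLift HeckeLinked` with its `hP4` binder discharged by ★
`UeP4OfFPiece.ue_P4_piece_of_F hF`. [cite: MumfordFogartyKirwan1994, App. 7A (p. 235)]
[cite: Milne2005ShimuraVarieties, §6 Thm. 6.11 pp. 74–75] [cite: PlatonovRapinchuk1994, §7.4 Thm. 7.12] -/
theorem thickLinkedLift_heckeLinked_pow (hF : lan2013_siegelFineModuliScheme) (g N : ℕ) (δ : Fin g → ℕ) (hg : 0 < g)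
    (hδ : IsPolarizationType δ) (hN : 3 ≤ N) (𝓜 : SiegelFineModuliScheme g N δ)
    (x : ComplexPoints ((Motives.baseChange ℚ ℂ).obj 𝓜.M)) (ℓ : ℕ) (hℓ : 2 ≤ ℓ) (hℓN : Nat.Coprime ℓ N) :
    ∃ (N' : ℕ) (δ' : Fin g → ℕ) (hδ' : IsPolarizationType δ') (𝓜' : SiegelFineModuliScheme g N' δ')
      (S'' : SchemeOver ℂ) (ι' : S'' ⟶ (Motives.baseChange ℚ ℂ).obj 𝓜'.M)
      (d'' : ℕ) (_ : SmoothOfRelativeDimension d'' S''.hom) (r' : gspFinAdelic δ') (_ : r' ∈ principalLevelSubgroup δ' 1)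
      (s' : ComplexPoints S''),
      (∃ K : ℕ, N' = N * ℓ ^ K) ∧
      EquidimOfF.IsThickAtWith hδ' 𝓜' ι' d'' s' r' ∧ HeckeLinked 𝓜 𝓜' r' (AlgPoints.map (L := ℂ) ι' s') x := by
  have hP4 := UeP4OfFPiece.ue_P4_piece_of_F hF
  have hLiftRD : ∀ {g : ℕ} {δ : Fin g → ℕ} (hg : 0 < g)
      (𝓜 : ∀ K : SiegelLevel δ, SiegelFineModuliScheme g K.N δ) {K K' : SiegelLevel δ} (f : K ⟶ K')
      (_hK : Smooth (𝓜 K).M.hom) (_hK' : Smooth (𝓜 K').M.hom)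
      {S'' S' : SchemeOver ℂ} (ι'' : S'' ⟶ (Motives.baseChange ℚ ℂ).obj (𝓜 K).M) [IsOpenImmersion ι''.left]
      (d'' : ℕ) [SmoothOfRelativeDimension d'' S''.hom]
      (ι : S' ⟶ (Motives.baseChange ℚ ℂ).obj (𝓜 K').M) [IsOpenImmersion ι.left] (d : ℕ) [SmoothOfRelativeDimension d S'.hom]
      (s'' : ComplexPoints S'') (s : ComplexPoints S'),
      AlgPoints.map ((Motives.baseChange ℚ ℂ).map (tr hg 𝓜 f)) (AlgPoints.map ι'' s'') = AlgPoints.map ι s → d ≤ d'' := by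
    intro g δ hg 𝓜 K K' f hK hK' S'' S' ι'' _ d'' _ ι _ d _ s'' s h
    exact SiegelModuliTower.trLiftsRelDim hg 𝓜 f hK hK' ι'' d'' ι d s'' s h
  classical
  haveI : IsLocallyNoetherian (specOver ℚ ℂ).left := inferInstanceAs (IsLocallyNoetherian (Spec (CommRingCat.of ℂ)))
  -- ### tower typing: `N = K₀.N`, `𝓜 = 𝓜f K₀`
  -- (the witnesses are hidden behind `have`s so that `K₀`, `𝓜f` stay OPAQUE locals — no `Function.update` unfolding later)
  have hK₀ : ∃ K₀ : SiegelLevel δ, K₀.N = N := ⟨SiegelLevel.ofNat δ N hN, SiegelLevel.N_ofNat hg N hN⟩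
  obtain ⟨K₀, rfl⟩ := hK₀
  have h𝓜f : ∃ 𝓜f : ∀ K : SiegelLevel δ, SiegelFineModuliScheme g K.N δ, 𝓜f K₀ = 𝓜 :=
    ⟨Function.update (fun K ↦ (hF g K.N δ hg hδ K.three_le_N).choose) K₀ 𝓜,
      Function.update_self (β := fun K : SiegelLevel δ ↦ SiegelFineModuliScheme g K.N δ) K₀ 𝓜 _⟩
  obtain ⟨𝓜f, rfl⟩ := h𝓜f
  have hN0 : 0 < K₀.N := by have := K₀.three_le_N; omega
  haveI : Fact (1 < K₀.N) := ⟨by have := K₀.three_le_N; omega⟩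
  -- ### `x`'s triple and its reading `(Zx, r)`, `r` of residue form
  obtain ⟨Px, -, -, -, hx⟩ := (𝓜f K₀).exists_triple_isBaseChangeVia_classifyingPoint_eq x
  obtain ⟨c, u₀, r, hu1, huc, hr, hmult, hrform, Zx, hZx, hPx⟩ := exists_residue_isAdmissibleAt hg hδ K₀.three_le_N Px
  have hUa := UHead.Ua_holds_of_residual Literature.AlgebraicGeometry.Motives.AbelianVariety.U_a3_residual_of_M13 g K₀.N δ hg
    hδ K₀.three_le_N c u₀ r hu1 huc hr hmult hrform
  -- ### H0_c: a thick piece with a point read at `r`; its period chart read at `r`; the open set `V` of periods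
  obtain ⟨S₀, ι₀, hι₀, d₀, hd₀, t₀, Z₀, hZ₀, P₀, hG, hadm₀, hcls₀⟩ :=
    EquidimThickPiece.exists_openPiece_le_at hF hP4 hg hδ K₀.three_le_N (𝓜f K₀) hr hUa
  haveI := hι₀
  haveI := hd₀
  haveI : Smooth S₀.hom := SmoothOfRelativeDimension.smooth d₀ _
  haveI : LocallyOfFiniteType S₀.hom := inferInstance
  obtain ⟨W, π, hWo, ht₀W, -, -, hread, hopen⟩ :=
    EquidimThickIffLe.isThickAtWith_of_isAdmissibleAt hF hg hδ K₀.three_le_N (𝓜f K₀) ι₀ d₀ t₀ hG hr (Z := ⟨Z₀, hZ₀⟩) P₀ hadm₀ hcls₀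
  obtain ⟨V, hVo, hVne, hVsub⟩ := hopen Set.univ isOpen_univ (Set.mem_univ _)
  -- ### B3+: the `ℓ`-adic move into `V`
  obtain ⟨P, γ, Kx, hPV, hJ, hγ, hγN, hγ', hsim⟩ :=
    exists_ellAdicMove_integral ℓ K₀.N hℓ hN0 hℓN hδ.1 ⟨Zx, hZx⟩ hVo hVne
  -- the moved period is the period of a point `t′` of the thick piece, with a triple `Q` admissible at `(P • Zx, r)`
  obtain ⟨t', ht', hπt'⟩ := hVsub ⟨_, hPV, rfl⟩
  obtain ⟨hπZ, Q, hQadm, hQcls⟩ := hread t' ht'.1.1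
  -- ### the upstairs level `K`, `K.N = N·ℓ^Kx`, and `f : K ⟶ K₀`
  have h3 : 3 ≤ K₀.N * ℓ ^ Kx := le_mul_of_le_of_one_le K₀.three_le_N (Nat.one_le_pow _ _ (by omega))
  have hKex : ∃ K : SiegelLevel δ, K.N = K₀.N * ℓ ^ Kx :=
    ⟨SiegelLevel.ofNat δ _ h3, SiegelLevel.N_ofNat hg _ h3⟩
  obtain ⟨K, hK⟩ := hKex
  have hle : K ≤ K₀ := by
    change (K.1 : Subgroup (gspFinAdelic δ)) ≤ K₀.1
    rw [SiegelLevel.val_eq, SiegelLevel.val_eq]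
    exact principalLevelSubgroup_anti δ (Dvd.intro _ hK.symm)
  let f : K ⟶ K₀ := homOfLE hle
  have hKN0 : K.N ≠ 0 := by have := K.three_le_N; omega
  -- smoothness of the members (for (R4))
  obtain ⟨hMsK, -, -⟩ := W1.smooth_qproj_of_F hF hg hδ K.three_le_N (𝓜f K)
  obtain ⟨hMsK₀, -, -⟩ := W1.smooth_qproj_of_F hF hg hδ K₀.three_le_N (𝓜f K₀)
  -- ### the THICK LIFT of `t′`
  obtain ⟨S'', ι', hι', -, -, d'', hd'', y, hdle, hy⟩ :=
    EquidimThickLift.exists_lift_le_relDim hF hg hδ 𝓜f f (SiegelModuliTower.exists_comp_tr_eq hg 𝓜f f)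
      (fun ι'' _ d'' _ ι _ d _ s'' s h ↦ hLiftRD hg 𝓜f f hMsK hMsK₀ ι'' d'' ι d s'' s h) ι₀ d₀ t'
  haveI := hι'
  haveI := hd''
  haveI : Smooth S''.hom := SmoothOfRelativeDimension.smooth d'' _
  haveI : LocallyOfFiniteType S''.hom := inferInstance
  -- ### `y`'s triple `P₀′` (level `K.N`), its shadow is classified like `Q` ⇒ admissible at `(P • Zx, r)`
  obtain ⟨P₀', -, -, -, hy'⟩ := (𝓜f K).exists_triple_isBaseChangeVia_classifyingPoint_eq (AlgPoints.map ι' y)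
  have hshadow : ∀ (m : ℕ) (hKm : K.N = K₀.N * m), m = K.N / K₀.N →
      IsAdmissibleAt hδ r _ hπZ (P₀'.changeLevel K₀.N m hKm hKN0) := by
    rintro m hKm rfl
    refine isAdmissibleAt_of_classifyingMap_eq hδ (𝓜f K₀) ?_ hQadm
    -- `cls Q = cls (shadow) = cls P₀′ ≫ tr f`, read on complex points: `cls Q ↦ ι₀ t′ = tr_ℂ (ι′ y)`
    apply (AlgPoints.baseChangeEquiv (algebraMap ℚ ℂ) (𝓜f K₀).M).injective
    rw [hQcls, ← classifyingMap_comp_tr hg 𝓜f f]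
    have hnat := Summit.HodgeConjecture.CorCM.D2Bridge.AlgPoints.baseChangeEquiv_map (algebraMap ℚ ℂ) (tr hg 𝓜f f)
      ((𝓜f K).classifyingMap (specOver ℚ ℂ) P₀')
    change AlgPoints.baseChangeEquiv (algebraMap ℚ ℂ) (𝓜f K₀).M (AlgPoints.map (tr hg 𝓜f f) _) =
      AlgPoints.map ((Motives.baseChange ℚ ℂ).map (tr hg 𝓜f f)) _ at hnat
    rw [AlgPoints.map_apply] at hnat
    rw [hnat, hy', hy]
  have hm : ℓ ^ Kx = K.N / K₀.N := by rw [hK, Nat.mul_div_cancel_left _ hN0]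
  have hadm_sh := hshadow (ℓ ^ Kx) hK hm
  -- ### (U): align the reading of `P₀′` to `(P • Zx, r·u)`
  obtain ⟨-, -, r₀, -, -, hr₀, -, -, Z₀', hZ₀', hP₀'read⟩ := exists_residue_isAdmissibleAt hg hδ K.three_le_N P₀'
  obtain ⟨u, hu, hadm'⟩ := exists_isAdmissibleAt_mul_of_changeLevel' hg hδ K₀.three_le_N hr hr₀
    (P • (⟨Zx, hZx⟩ : siegelUpperHalfSpace g)) ⟨Z₀', hZ₀'⟩ (Nat.pow_pos (by omega)) K.N hK hKN0 P₀' hP₀'read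
    (by simpa [hπt'] using hadm_sh)
  have hru : r * u ∈ principalLevelSubgroup δ 1 :=
    Subgroup.mul_mem _ hr (principalLevelSubgroup_anti δ (one_dvd K₀.N) hu)
  -- ### thickness at `y` read at `r·u`, and the link
  have hthick : EquidimOfF.IsThickAtWith hδ (𝓜f K) ι' d'' y (r * u) :=
    EquidimThickIffLe.isThickAtWith_of_isAdmissibleAt hF hg hδ K.three_le_N (𝓜f K) ι' d'' y (hG.trans hdle) hru
      (Z := P • (⟨Zx, hZx⟩ : siegelUpperHalfSpace g)) P₀' hadm' hy'
  have hlink : HeckeLinked (𝓜f K₀) (𝓜f K) (r * u) (AlgPoints.map (L := ℂ) ι' y) x :=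
    heckeLinked_at_ellAdicMove' hg hδ K₀.three_le_N hℓ K.N hK (𝓜f K₀) (𝓜f K) P γ hJ hγ hγ' hsim hγN hr hu
      ⟨Zx, hZx⟩ Px hPx hx P₀' hadm' hy'
  exact ⟨K.N, δ, hδ, 𝓜f K, S'', ι', d'', hd'', r * u, hru, y, ⟨Kx, hK⟩, hthick, hlink⟩


/-- **SOCKET (A), v6 TEXT: the thick Hecke-linked lift WITH `N′/N` ODD** (B-plan1 (g14) 2026-08-29T21:50:29Z: socket (B)'s
ampleness argument needs `d = N′/N` odd).  Take `ℓ := 2N+1` (odd, `≥ 2`, prime to `N`) in `thickLinkedLift_heckeLinked_pow`: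
`N′ = N·ℓᴷ`, so `N′/N = ℓᴷ` is odd. [cite: MumfordFogartyKirwan1994, App. 7A (p. 235)]
[cite: Milne2005ShimuraVarieties, §6 Thm. 6.11 pp. 74–75] -/
theorem thickLinkedLift_heckeLinked_odd (hF : lan2013_siegelFineModuliScheme) (g N : ℕ) (δ : Fin g → ℕ) (hg : 0 < g)
    (hδ : IsPolarizationType δ) (hN : 3 ≤ N) (𝓜 : SiegelFineModuliScheme g N δ)
    (x : ComplexPoints ((Motives.baseChange ℚ ℂ).obj 𝓜.M)) :
    ∃ (N' : ℕ) (δ' : Fin g → ℕ) (hδ' : IsPolarizationType δ') (𝓜' : SiegelFineModuliScheme g N' δ')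
      (S'' : SchemeOver ℂ) (ι' : S'' ⟶ (Motives.baseChange ℚ ℂ).obj 𝓜'.M)
      (d'' : ℕ) (_ : SmoothOfRelativeDimension d'' S''.hom) (r' : gspFinAdelic δ') (_ : r' ∈ principalLevelSubgroup δ' 1)
      (s' : ComplexPoints S''),
      EquidimOfF.IsThickAtWith hδ' 𝓜' ι' d'' s' r' ∧ HeckeLinked 𝓜 𝓜' r' (AlgPoints.map (L := ℂ) ι' s') x ∧ Odd (N' / N) := by
  have hN0 : 0 < N := by omega
  have hcop : Nat.Coprime (2 * N + 1) N := by
    rw [two_mul, add_assoc]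
    exact Nat.coprime_self_add_left.mpr (Nat.coprime_self_add_left.mpr (Nat.coprime_one_left _))
  obtain ⟨N', δ', hδ', 𝓜', S'', ι', d'', hd'', r', hr', s', ⟨K, hK⟩, hthick, hlink⟩ :=
    thickLinkedLift_heckeLinked_pow hF g N δ hg hδ hN 𝓜 x (2 * N + 1) (by omega) hcop
  refine ⟨N', δ', hδ', 𝓜', S'', ι', d'', hd'', r', hr', s', hthick, hlink, ?_⟩
  rw [hK, Nat.mul_div_cancel_left _ hN0]
  exact Odd.pow ⟨N, by ring⟩

end EquidimSocketThickLinkedLift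

end Summit.HodgeConjecture.HodgeConjecture.Theorems

end
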